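import Mathlib
import HarnessLib
import Summits.AtomisticToContinuum.BoseEinsteinCondensation.Theses.BECHeatBathGap

/-!
# Route BECHeatBathGap — the frame support `WitnessToBEC` (item stmt-AtomisticToContinuum-14372)

`SomeNearMinimiserCondenses → NearMinimiserStability → GroundStateRigidity → BoseEinsteinCondensation`.

Proof (pure glue over the Literature Bose-gas vocabulary): for `v` repulsive finite-range take
`ρ₀ = min ρ₁ ρ₂` of the two thresholds; for `0 < ρ < ρ₀` get `c > 0` and, eventually in `N`, the
"for every slack `δ > 0` some `δ`-near-minimiser of the `(N+1)`-body Dirichlet energy has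
`maxOccupation ≥ ofReal (c (N+1))`" statement; feed it to `NearMinimiserStability` (from
`GroundStateRigidity`) at index `N + 1` with `m = ofReal (c (N+1))` to get a slack `δ > 0` at which
EVERY `δ`-near-minimiser has `maxOccupation ≥ m / 2`; `le_condensateNumber` turns this into
`m / 2 ≤ condensateNumber v (N+1) (sideLength ρ (N+1))`, and the index shift `∀ᶠ N ↦ N + 1`
(`Filter.eventually_atTop`) gives `HasGroundStateBEC v ρ` with constant `c / 2`.

The same argument is the `have h7 : WitnessToBEC` step of the route's deciding theorem `closes`
(Theses/BECHeatBathGap.lean, rev 5); this file lands it as a stand-alone theorem whose type is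
literally the route decl, closing the item.
-/

namespace Summit.AtomisticToContinuum.BoseEinsteinCondensation.Theorems

/-- **WitnessToBEC** (route BECHeatBathGap, support item stmt-AtomisticToContinuum-14372):
`SomeNearMinimiserCondenses → NearMinimiserStability → GroundStateRigidity →
BoseEinsteinCondensation`. With `ρ₀ = min` of the thresholds of the first two hypotheses
(stability being instantiated with the rigidity hypothesis), eventually in `N` apply stability at
index `N + 1` with `m = ENNReal.ofReal (c * (N + 1))`, then
`Literature.MathematicalPhysics.QuantumManyBody.BoseGas.le_condensateNumber` and the index shift
`N ↦ N + 1`; the BEC constant is `c / 2`. -/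
theorem witnessToBEC_proof :
    Summit.AtomisticToContinuum.BoseEinsteinCondensation.Theses.BECHeatBathGap.WitnessToBEC := by
  unfold Summit.AtomisticToContinuum.BoseEinsteinCondensation.Theses.BECHeatBathGap.WitnessToBEC
  intro hS hStab hR v hv
  obtain ⟨ρ₁, hρ₁, H1⟩ := hS v hv
  obtain ⟨ρ₂, hρ₂, H2⟩ := hStab hR v hv
  refine ⟨min ρ₁ ρ₂, lt_min hρ₁ hρ₂, fun ρ hρ hρlt => ?_⟩
  obtain ⟨c, hc, hN1⟩ := H1 ρ hρ (hρlt.trans_le (min_le_left _ _))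
  obtain ⟨N₁, hN₁⟩ := Filter.eventually_atTop.1 hN1
  obtain ⟨N₂, hN₂⟩ := Filter.eventually_atTop.1 (H2 ρ hρ (hρlt.trans_le (min_le_right _ _)))
  refine ⟨c / 2, by positivity, Filter.eventually_atTop.2 ⟨max (N₁ + 1) N₂, fun M hM => ?_⟩⟩
  -- index shift: every `M ≥ N₁ + 1` is a successor `N + 1` with `N ≥ N₁`
  obtain ⟨N, rfl⟩ : ∃ N, M = N + 1 := ⟨M - 1, by have := le_of_max_le_left hM; omega⟩
  -- stability at index `N + 1` with `m = ofReal (c (N + 1))`, fed by the condensing witnesses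
  obtain ⟨δ, hδ, hall⟩ := hN₂ (N + 1) (le_of_max_le_right hM) (ENNReal.ofReal (c * (N + 1 : ℕ)))
    (fun δ hδ => by
      obtain ⟨Ψ, hΨ, hocc⟩ := hN₁ N (by have := le_of_max_le_left hM; omega) δ hδ
      exact ⟨Ψ, hΨ, by push_cast; exact hocc⟩)
  -- `ofReal ((c/2)(N+1)) = ofReal (c (N+1)) / 2 ≤ condensateNumber` by `le_condensateNumber`
  calc ENNReal.ofReal (c / 2 * ((N + 1 : ℕ) : ℝ)) = ENNReal.ofReal (c * (N + 1 : ℕ)) / 2 := by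
        rw [show c / 2 * ((N + 1 : ℕ) : ℝ) = c * (N + 1 : ℕ) / 2 by ring,
          ENNReal.ofReal_div_of_pos two_pos, ENNReal.ofReal_ofNat]
    _ ≤ _ := Literature.MathematicalPhysics.QuantumManyBody.BoseGas.le_condensateNumber v hδ hall

end Summit.AtomisticToContinuum.BoseEinsteinCondensation.Theorems
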